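/-
COR-CM (cell pub-hodgecm2, stage 2 of the Hodge ladder) — count-neutral KERNEL COMBINATORICS «the octic product column G = Q₈ × B, D₄ × B: generation»
(seat prover-pub-hodgecm2-b23-g45-0, binder prover b23, gen 45; own census lane OCTIC-PRODUCT, claim HOME/INBOX.md l.18829).  Bookkeeping definitions with bodies (`rep`, `redFace`, `redFaces`, `family`) + theorems — gen 44ʼs `Census/QuarticInversionGeneration.lean` over the motions `twH₄`, `twZ ζ` (central `y`), `twT` (its label-level parts `redSet`, `killed_of_mem`, `cover_translH₄/T` BY NAME); no `decide`, no certificate, no named fact, no `sorry`.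
`Interfaces.lean` (C1), every E term, B01, `Transposition/*`, `PortJoin/*`, `D2Bridge/*` untouched.
HONEST FRAMING: `HC_CM` is NOT proved, here or anywhere in the tree; nothing here is a period, a count of record or a headline.
T5: n/a-class (hypothesis binders = the datum equations / the slot data only); checker: self, 2026-08-24.
-/
import Summits.HodgeConjecture.CorCM.Census.QuarticInversionGeneration
import Summits.HodgeConjecture.CorCM.Census.OcticProductLattice
import Summits.HodgeConjecture.CorCM.Census.OcticProductResidualBlocks

/-!
# The octic product column: GENERATION — the Hodge lattice of the model is spanned, modulo pairs, by the translates of one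
# reducing face per non-residual block and the ten closing faces

COR-CM (cell `pub-hodgecm2`, stage 2 of the Hodge ladder), count-neutral KERNEL COMBINATORICS by the binder seat b23 (gen 45; lane OCTIC-PRODUCT, HOME/INBOX.md l.18829 — the port of gen 44ʼs quartic inversion lane `Census/QuarticInversion*` to the datum with `y` CENTRAL on `ι(H₀)`).  On top of the corresponding parts of gen 44ʼs lane `Census/QuarticInversion*` (label-level, BY NAME) and the preceding `Census/OcticProduct*` files.  Bookkeeping
definitions with bodies (`redSet`, `rep`, `redFace`, `redFaces`, `family`) + theorems; no `decide`, no certificate, no named fact, no geometry,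
no `sorry`.  `Interfaces.lean` (C1), every E term, B01, `Transposition/*`, `PortJoin/*`, `D2Bridge/*` untouched.
HONEST FRAMING: `HC_CM` is NOT proved, here or anywhere in the tree; nothing here is a period, a count of record or a headline.

CONTENT (`|B|` odd `≥ 3`, square class `ζ`, a slot datum `(P,u₁,u₂;Q,w,u₀)` and a cross datum `(σ,s₀)` as in gen 44ʼs part XVII).
* §1 The set of all reducing faces is motion-stable, and the functionals of part VII kill the pairs and its span.
* §2 **The block faces**: one reducing face through a representative of every non-residual block; their orbit span covers every non-residual
  label by a potential-lowering vector (the cover moves along chains of motions).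
* §3 **GENERATION** (`hodge₄_le`): `hodge₄ ≤ pairs₄ ⊔ orbSpan (redFaces ∪ B1)`.  For `x ∈ hodge₄`: `Census/OcticProductLattice` gives `c ∈ orbSpan B1` with the
  same values under every functional; the descent of part VI reduces `x − c` modulo `orbSpan redFaces` to a residual vector, killed by every
  functional, hence a sum of pairs by the key lemma of part IX.
* §4 **THE COUNT** (`card_genFamily_le`, `card_genFamily_add_two_le`): the family has at most `#Block` members for every `ζ`, at most `#Block − 2`
  for `ζ = 0` (`Census/OcticProductResidualBlocks`).  All [folklore].

## References
* [Pohlmann1968] H. Pohlmann, Algebraic cycles on abelian varieties of complex multiplication type, Ann. of Math. 88 (1968), Thm 1.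
-/

namespace Summit.HodgeConjecture.CorCM.Census.OcticProduct

open Finset
open Summit.HodgeConjecture.CorCM.Census.OddSliceFacesModel

open Summit.HodgeConjecture.CorCM.Census.QuarticInversion (Ty₄ card_famB1_le coord corner cover_translH₄ cover_translT descent_of_cover exists_reducing faceVec₄ faceVec₄_mem faceVec₄_reducing famB1 famB1_subset_hodge₄ family fnl half hodge₄ hv killed_of_mem mem_pairs₄_of_killed orbSpan_mono pairs₄ pot₄ pot₄_le redSet rep translH₄_mem_span_redSet translT_mem_span_redSet twH₄ twT wA wC)

noncomputable section

variable (A : Type) [AddCommGroup A] [Fintype A] [DecidableEq A] (ζ : ZMod 2)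

/-! ## §1 Reducing faces: motion-stable, killed by the functionals -/

/-- The span of the reducing faces is stable under the central `y`. [folklore] -/
theorem translZ_mem_span_redSet (hA : Odd (Fintype.card A)) {v : Ty₄ A → ℤ} (hv : v ∈ Submodule.span ℤ (redSet A)) :
    translZ A ζ v ∈ Submodule.span ℤ (redSet A) := by
  have hle : (Submodule.span ℤ (redSet A)).map (translZHom A ζ) ≤ Submodule.span ℤ (redSet A) := by
    rw [Submodule.map_span]
    refine Submodule.span_mono ?_
    rintro _ ⟨u, ⟨Θ, p, q, h, rfl⟩, rfl⟩
    exact ⟨twZ A ζ Θ, plZ A p, plZ A q, reducing_twZ A hA ζ h, by rw [translZHom_apply, translZ_faceVec₄]⟩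
  exact hle (Submodule.mem_map_of_mem (f := translZHom A ζ) hv)

/-! ## §2 The block faces and their covering property -/

/-- A label in each block (a choice). [folklore] -/
def repOf (B : Block A ζ) : Ty₄ A := Quotient.out B

omit [Fintype A] [DecidableEq A] in
/-- `repOf B` lies in `B`. [folklore] -/
theorem blk_repOf (B : Block A ζ) : blk A ζ (repOf A ζ B) = B := Quotient.out_eq B

omit [DecidableEq A] in
/-- The potential of the representative is the potential of the block. [folklore] -/
theorem pot₄_repOf (B : Block A ζ) : pot₄ A (repOf A ζ B) = potB A ζ B := by
  rw [← potB_blk A ζ, blk_repOf]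

/-- **The block face**: the reducing face of part VI through the representative (junk `0` for residual blocks). [folklore] -/
def redFace (B : Block A ζ) : Ty₄ A → ℤ :=
  if h : 2 ≤ pot₄ A (repOf A ζ B) then
    faceVec₄ A (repOf A ζ B) (Classical.choose (exists_reducing A h)) (Classical.choose (Classical.choose_spec (exists_reducing A h)))
  else 0

/-- The block face of a non-residual block is a reducing face through its representative. [folklore] -/
theorem redFace_spec {B : Block A ζ} (hB : 2 ≤ potB A ζ B) :
    ∃ p q, (p ≠ q ∧ ∀ c, pot₄ A (corner A (repOf A ζ B) p q c) < pot₄ A (repOf A ζ B) ∧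
      ∀ n, half A (coord A n (corner A (repOf A ζ B) p q c)) = half A (coord A n (repOf A ζ B))) ∧
      redFace A ζ B = faceVec₄ A (repOf A ζ B) p q := by
  have h : 2 ≤ pot₄ A (repOf A ζ B) := by rw [pot₄_repOf]; exact hB
  refine ⟨_, _, Classical.choose_spec (Classical.choose_spec (exists_reducing A h)), ?_⟩
  rw [redFace, dif_pos h]

/-- **The block faces**: one per non-residual block. [folklore] -/
def redFaces : Finset (Ty₄ A → ℤ) := (univ.filter fun B : Block A ζ => 2 ≤ potB A ζ B).image (redFace A ζ)

/-- Block faces are reducing faces. [folklore] -/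
theorem redFaces_subset_redSet : (↑(redFaces A ζ) : Set (Ty₄ A → ℤ)) ⊆ redSet A := by
  intro v hv
  obtain ⟨B, hB, rfl⟩ := Finset.mem_image.mp (Finset.mem_coe.mp hv)
  obtain ⟨p, q, h, e⟩ := redFace_spec A ζ (Finset.mem_filter.mp hB).2
  exact ⟨_, p, q, h, e⟩

/-- Block faces are Hodge vectors. [folklore] -/
theorem redFaces_subset_hodge₄ : (↑(redFaces A ζ) : Set (Ty₄ A → ℤ)) ⊆ hodge₄ A := by
  intro v hv
  obtain ⟨Θ, p, q, h, rfl⟩ := redFaces_subset_redSet A ζ hv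
  exact faceVec₄_mem A Θ h.1

/-- There are at most as many block faces as non-residual blocks. [folklore] -/
theorem card_redFaces_le : (redFaces A ζ).card ≤ (univ.filter fun B : Block A ζ => 2 ≤ potB A ζ B).card :=
  Finset.card_image_le

/-- The orbit span of the block faces lies in the span of all reducing faces. [folklore] -/
theorem orbSpan_redFaces_le (hA : Odd (Fintype.card A)) : orbSpan A ζ ↑(redFaces A ζ) ≤ Submodule.span ℤ (redSet A) :=
  orbSpan_le A ζ (fun _ hv => Submodule.subset_span (redFaces_subset_redSet A ζ hv))
    (fun g _ hv => translH₄_mem_span_redSet A hA g hv) (fun _ hv => translZ_mem_span_redSet A ζ hA hv)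
    (fun _ hv => translT_mem_span_redSet A hA hv)

omit [DecidableEq A] in
/-- A covering vector moves with the central `y`. [folklore] -/
theorem cover_translZ {v : Ty₄ A → ℤ} {Θ : Ty₄ A} (hv : v Θ = 1 ∧ ∀ χ, χ ≠ Θ → v χ ≠ 0 → pot₄ A χ < pot₄ A Θ) :
    translZ A ζ v (twZ A ζ Θ) = 1 ∧ ∀ χ, χ ≠ twZ A ζ Θ → translZ A ζ v χ ≠ 0 → pot₄ A χ < pot₄ A (twZ A ζ Θ) := by
  have e : ∀ χ, translZ A ζ v χ = v (twZinv A ζ χ) := fun χ => rfl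
  refine ⟨by rw [e, twZinv_twZ]; exact hv.1, fun χ hχ hne => ?_⟩
  rw [e] at hne
  have hχ' : twZinv A ζ χ ≠ Θ := fun h => hχ (by rw [← h, twZ_twZinv])
  have := hv.2 _ hχ' hne
  rwa [← pot₄_twZ A ζ (twZinv A ζ χ), twZ_twZinv, ← pot₄_twZ A ζ Θ] at this

omit [DecidableEq A] in
/-- **Covers move along chains of motions** inside an orbit span. [folklore] -/
theorem cover_of_reach (F : Set (Ty₄ A → ℤ)) {Θ Θ' : Ty₄ A}
    (hreach : Relation.ReflTransGen
      (fun Θ₁ Θ₂ : Ty₄ A => (∃ g : ZMod 2 × A, Θ₂ = twH₄ A g Θ₁) ∨ Θ₂ = twZ A ζ Θ₁ ∨ Θ₂ = twT A Θ₁) Θ Θ')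
    (hcov : ∃ v ∈ orbSpan A ζ F, v Θ = 1 ∧ ∀ χ, χ ≠ Θ → v χ ≠ 0 → pot₄ A χ < pot₄ A Θ) :
    ∃ v ∈ orbSpan A ζ F, v Θ' = 1 ∧ ∀ χ, χ ≠ Θ' → v χ ≠ 0 → pot₄ A χ < pot₄ A Θ' := by
  induction hreach with
  | refl => exact hcov
  | tail _ hs ih =>
    obtain ⟨v, hvF, hv⟩ := ih
    rcases hs with ⟨g, rfl⟩ | rfl | rfl
    · exact ⟨_, translH₄_mem_orbSpan A ζ F g hvF, cover_translH₄ A g hv⟩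
    · exact ⟨_, translZ_mem_orbSpan A ζ F hvF, cover_translZ A ζ hv⟩
    · exact ⟨_, translT_mem_orbSpan A ζ F hvF, cover_translT A hv⟩

/-- **The orbit span of the block faces covers every non-residual label.** [folklore] -/
theorem redFaces_cover (Ψ : Ty₄ A) (hΨ : 2 ≤ pot₄ A Ψ) :
    ∃ v ∈ orbSpan A ζ ↑(redFaces A ζ), v Ψ = 1 ∧ ∀ χ, χ ≠ Ψ → v χ ≠ 0 → pot₄ A χ < pot₄ A Ψ := by
  set B := blk A ζ Ψ with hBdef
  have hB : 2 ≤ potB A ζ B := by rw [hBdef, potB_blk]; exact hΨ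
  have hreach := (blk_eq_blk_iff A ζ (repOf A ζ B) Ψ).mp (blk_repOf A ζ B)
  obtain ⟨p, q, h, e⟩ := redFace_spec A ζ hB
  refine cover_of_reach A ζ _ hreach ⟨redFace A ζ B, subset_orbSpan A ζ _ ?_, ?_⟩
  · exact Finset.mem_coe.mpr (Finset.mem_image_of_mem _ (Finset.mem_filter.mpr ⟨Finset.mem_univ _, hB⟩))
  · rw [e]; exact faceVec₄_reducing A fun c => (h.2 c).1

/-! ## §3 Generation -/

omit [Fintype A] [DecidableEq A] in
/-- Orbit spans are monotone in the family. [folklore] -/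
private theorem orbSpan_mono {F F' : Set (Ty₄ A → ℤ)} (h : F ⊆ F') : orbSpan A ζ F ≤ orbSpan A ζ F' :=
  orbSpan_le A ζ (fun _ hf => subset_orbSpan A ζ F' (h hf)) (fun g _ hv => translH₄_mem_orbSpan A ζ F' g hv)
    (fun _ hv => translZ_mem_orbSpan A ζ F' hv) (fun _ hv => translT_mem_orbSpan A ζ F' hv)

/-- **The generating family**: the block faces and the ten closing faces. [folklore] -/
def genFamily (P : Finset A) (u₁ u₂ : A) (Q : Finset A) (w u₀ : A) : Finset (Ty₄ A → ℤ) :=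
  redFaces A ζ ∪ famB1 A P u₁ u₂ Q w u₀

section Gen
variable {P : Finset A} {u₁ u₂ : A} {Q : Finset A} {w u₀ σ s₀ : A}

/-- **GENERATION: `hodge₄ ≤ pairs₄ ⊔ orbSpan (redFaces ∪ B1)`** (`|B|` odd `≥ 3`, slot datum, cross datum). [folklore] -/
theorem hodge₄_le (hA : Odd (Fintype.card A)) (h3 : 3 ≤ Fintype.card A) (h1 : u₁ ∉ P) (h2 : u₂ ∉ P) (h12 : u₁ ≠ u₂)
    (hP : P.card + 1 = Fintype.card A / 2) (hs₀ : s₀ ∈ insert u₁ (insert u₂ P))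
    (hX : ∀ s, s + σ ∈ insert u₁ (insert u₂ P) ↔ (s ∉ insert u₁ (insert u₂ P) ∨ s = s₀)) (hw : w ∉ Q)
    (hQ : Q.card = Fintype.card A / 2) :
    hodge₄ A ≤ pairs₄ A ⊔ orbSpan A ζ ↑(genFamily A ζ P u₁ u₂ Q w u₀) := by
  intro x hx
  obtain ⟨c, hc, hAc⟩ := Submodule.mem_map.mp (Avec_mem_valMod_of_hodge A hA h3 ζ h1 h2 h12 hP hs₀ hX hw hQ (u₀ := u₀) hx)
  have hcH : c ∈ hodge₄ A := orbSpan_le_hodge₄ A ζ (famB1_subset_hodge₄ A (P := P) (Q := Q) (w := w) (u₀ := u₀) h12) hc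
  obtain ⟨r, hres, hmem⟩ := descent_of_cover (pot₄ A) (orbSpan A ζ ↑(redFaces A ζ)) (redFaces_cover A ζ)
    (4 * Fintype.card A) (x - c) (fun χ _ => pot₄_le A χ)
  have hkill := killed_of_mem A hA (Submodule.mem_sup_right (orbSpan_redFaces_le A ζ hA hmem))
  have hval : ∀ w', (fnl A w' x = fnl A w' c) → fnl A w' (x - c - r) = 0 → fnl A w' r = 0 := by
    intro w' h h'
    rw [map_sub, map_sub, h, sub_self, zero_sub, neg_eq_zero] at h'
    exact h'
  have hkA : ∀ j η u, fnl A (wA A j η u) r = 0 := fun j η u =>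
    hval _ (by have := congrFun hAc (Sum.inl (j, η, u)); simpa using this.symm) (hkill.1 j η u)
  have hkC : ∀ η, fnl A (wC A η) r = 0 := fun η =>
    hval _ (by have := congrFun hAc (Sum.inr η); simpa using this.symm) (hkill.2 η)
  have hr : r ∈ pairs₄ A := mem_pairs₄_of_killed A hA h3 hres hkA hkC
  have e : x = c + (x - c - r) + r := by abel
  rw [e]
  refine Submodule.add_mem _ (Submodule.add_mem _ (Submodule.mem_sup_right ?_) (Submodule.mem_sup_right ?_))
    (Submodule.mem_sup_left hr)
  · exact orbSpan_mono A ζ (by simp [genFamily]) hc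
  · exact orbSpan_mono A ζ (by simp [genFamily]) hmem

/-! ## §4 The count -/

/-- **`#family ≤ #Block`** for every `ζ` (`|B|` odd `≥ 3`). [folklore] -/
theorem card_genFamily_le (hA : Odd (Fintype.card A)) (h2 : 2 ≤ Fintype.card A) :
    (genFamily A ζ P u₁ u₂ Q w u₀).card ≤ Fintype.card (Block A ζ) := by
  have hu := Finset.card_union_le (redFaces A ζ) (famB1 A P u₁ u₂ Q w u₀)
  have hb := card_redFaces_le A ζ
  have hf := card_famB1_le A P u₁ u₂ Q w u₀
  have hten := ten_le_card_residual A ζ hA h2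
  have hpart := Finset.card_filter_add_card_filter_not (s := (univ : Finset (Block A ζ))) (fun B => potB A ζ B < 2)
  have hneg : (univ.filter fun B : Block A ζ => ¬ potB A ζ B < 2) = univ.filter fun B : Block A ζ => 2 ≤ potB A ζ B := by
    refine Finset.filter_congr fun B _ => ?_; omega
  rw [hneg, Finset.card_univ] at hpart
  unfold genFamily
  omega

/-- **`#family + 2 ≤ #Block` for `ζ = 0`** (`|B|` odd `≥ 3`). [folklore] -/
theorem card_genFamily_add_two_le (hA : Odd (Fintype.card A)) (h2 : 2 ≤ Fintype.card A) :
    (genFamily A 0 P u₁ u₂ Q w u₀).card + 2 ≤ Fintype.card (Block A 0) := by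
  have hu := Finset.card_union_le (redFaces A 0) (famB1 A P u₁ u₂ Q w u₀)
  have hb := card_redFaces_le A 0
  have hf := card_famB1_le A P u₁ u₂ Q w u₀
  have htw := twelve_le_card_residual A hA h2
  have hpart := Finset.card_filter_add_card_filter_not (s := (univ : Finset (Block A 0))) (fun B => potB A 0 B < 2)
  have hneg : (univ.filter fun B : Block A 0 => ¬ potB A 0 B < 2) = univ.filter fun B : Block A 0 => 2 ≤ potB A 0 B := by
    refine Finset.filter_congr fun B _ => ?_; omega
  rw [hneg, Finset.card_univ] at hpart
  unfold genFamily
  omega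

/-- The family consists of faces of the model: `faceVec₄ Θ p q` with `p ≠ q`. [folklore] -/
theorem genFamily_shape (h12 : u₁ ≠ u₂) {f : Ty₄ A → ℤ} (hf : f ∈ genFamily A ζ P u₁ u₂ Q w u₀) :
    ∃ Θ p q, p ≠ q ∧ f = faceVec₄ A Θ p q := by
  rcases Finset.mem_union.mp hf with hf | hf
  · obtain ⟨Θ, p, q, h, e⟩ := redFaces_subset_redSet A ζ (Finset.mem_coe.mpr hf)
    exact ⟨Θ, p, q, h.1, e⟩
  · obtain ⟨k, -, rfl⟩ := Finset.mem_image.mp hf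
    have hne : ((0 : Fin 4), u₁) ≠ ((0 : Fin 4), u₂) := fun e => h12 (Prod.mk.inj e).2
    have hne1 : ∀ u u' : A, ((0 : Fin 4), u) ≠ ((1 : Fin 4), u') := fun u u' e => absurd (Prod.mk.inj e).1 (by decide)
    have hne2 : ∀ u u' : A, ((0 : Fin 4), u) ≠ ((2 : Fin 4), u') := fun u u' e => absurd (Prod.mk.inj e).1 (by decide)
    fin_cases k
    · exact ⟨_, _, _, hne, rfl⟩
    · exact ⟨_, _, _, hne, rfl⟩
    · exact ⟨_, _, _, hne, rfl⟩
    · exact ⟨_, _, _, hne, rfl⟩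
    · exact ⟨_, _, _, hne, rfl⟩
    · exact ⟨_, _, _, hne1 _ _, rfl⟩
    · exact ⟨_, _, _, hne2 _ _, rfl⟩
    · exact ⟨_, _, _, hne1 _ _, rfl⟩
    · exact ⟨_, _, _, hne1 _ _, rfl⟩
    · exact ⟨_, _, _, hne1 _ _, rfl⟩

end Gen

end

end Summit.HodgeConjecture.CorCM.Census.OcticProduct
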